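import Summits.NavierStokesRegularity.NavierStokesRegularity.Theorems.SelfMixingDichotomyMixingPayoffWindowRegularityTools
import Literature.Analysis.FluidPDE.ClassicalSolution
import Literature.Analysis.FluidPDE.LerayHopf
import Literature.Analysis.FluidPDE.NSWave0
import Literature.Analysis.FluidPDE.TaoLocalisation
import Literature.Analysis.FluidPDE.TaoLocalisationHolds
import Literature.Analysis.FluidPDE.TaoLocalisationProofs
import Literature.Analysis.FluidPDE.TaoLocalisationContinuation
import HarnessLib

/-!
# Crux `MixingPayoff` (stmt-NavierStokesRegularity-1422), line `birth`: STUB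
  `stub_windowRegularity` (W1 — all space–time derivatives of the NS velocity are bounded on a
  closed sub-slab)

Proof file (lands `--supports stmt-NavierStokesRegularity-1422`) for the registered stub
`stub_windowRegularity` of the skeleton `Cruxes/MixingPayoff/Lines/birth.lean`, verbatim: for a
standing solution (`0 < T`, `(u, p)` classical on `[0, T) × ℝ³` with `ν = 1`, `f = 0`,
Leray–Hopf from `u 0`, rapidly decaying datum) and `0 ≤ a < b < T`, the velocity is jointly
smooth on `[a, b] × ℝ³` and every iterated space–time derivative of `uncurry u` within
`[a, b] × ℝ³` is bounded there — the hypothesis on the drift consumed by the neighbouring stub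
`stub_advectionDiffusionSchwartz` (W2).

Argument.
* `windowRegularity_closedSlab` — **a classical solution on a closed slab `[0, T'] × ℝ³` with all
  Sobolev norms bounded has all joint derivatives within the slab bounded** (the pointwise form
  of Tao 2011, Thm. 5.4 (iv), "`∂ₜʲ u ∈ L^∞_t H^k_x` for all `j, k`"): with the `H¹` budget
  `Ab = sup_t ∫|u|² + 3 sup_t ∫‖Du‖²` the restart step `windowRegularity_restart` (tools file:
  Tao's local theorem with all derivatives bounded, `w1aux_localExistenceAllDerivs`, and
  Prodi–Serrin weak–strong uniqueness) covers `[s, min(s + τ, T')]` for every `s ∈ [0, T')` with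
  a uniform `τ = c/(Ab² + 1)`; induction on the number of restarts (as in the tree's
  `tao2011_hasBoundedSobolevNormsOn_of_localExistence_of_apriori`).
* `stub_windowRegularity` — restrict the standing solution to the closed slab `[0, b']`,
  `b' = (b + T)/2` (`IsClassicalNSSolutionOn.mono`); finite energy there by the Leray–Hopf energy
  inequality (`IsLerayHopfOn.lintegral_enorm_sq_le`); all Sobolev norms bounded by Tao 2011,
  Cor. 11.1 + Cor. 4.3 + Thm. 5.4 (iv) (`tao2011_hasBoundedSobolevNormsOn_holds`, proved in the
  tree); `windowRegularity_closedSlab`; and the derivatives within `[a, b] × ℝ³` agree with those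
  within `[0, b'] × ℝ³` on the smaller slab (`iteratedFDerivWithin_subset`). Joint smoothness on
  `[a, b]` is `IsSmoothSpaceTimeOn.mono`.

Everything is proved (standard axioms); no definition, no named fact. References: T. Tao,
Anal. PDE 6 (2013) = arXiv:1108.1165, Cor. 11.1, Cor. 4.3, Thm. 5.4; J. C. Robinson,
J. L. Rodrigo, W. Sadowski, *The Three-Dimensional Navier–Stokes Equations* (CUP 2016),
Lemma 6.11, Thm. 8.19.
-/

noncomputable section

open scoped ContDiff ENNReal NNReal
open Literature.Analysis.FluidPDE MeasureTheory Set Function Metric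

-- `Summit = Problem` for this summit; the tree lakefile sets `weak.linter.dupNamespace = false`.
set_option linter.dupNamespace false

namespace Summit.NavierStokesRegularity.NavierStokesRegularity.Theorems

local notation "E3" => EuclideanSpace ℝ (Fin 3)

/-- **All space–time derivatives of a classical solution with bounded Sobolev norms on a closed
slab are bounded there** (Tao 2011, Thm. 5.4 (iv): the solution is, on every sub-slab of length
`τ`, the `H¹` mild solution from its own `H^∞` datum, whose time derivatives of all orders lie in
`L^∞_t H^k_x`; here in the pointwise form, by finitely many restarts `windowRegularity_restart`
with the uniform lifespan given by the `H¹` budget `sup_t ∫|u|² + 3 sup_t ∫‖Du‖²`). -/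
theorem windowRegularity_closedSlab {ν T : ℝ} (hν : 0 < ν) (hT : 0 < T) {u : ℝ → E3 → E3}
    {p : ℝ → E3 → ℝ} (hsol : IsClassicalNSSolutionOn (Icc 0 T) ν 0 u p)
    (hH : HasBoundedSobolevNormsOn (Icc 0 T) u) (n : ℕ) :
    ∃ C : ℝ, ∀ t ∈ Icc 0 T, ∀ x : E3,
      ‖iteratedFDerivWithin ℝ n (uncurry u) (Icc 0 T ×ˢ univ) (t, x)‖ ≤ C := by
  -- the `H¹` budget at restart times
  obtain ⟨D₀, hD₀⟩ := hH 0
  obtain ⟨D₁, hD₁⟩ := hH 1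
  set Ab : ℝ := (D₀ : ℝ) + 3 * (D₁ : ℝ) with hAbdef
  have hAb : 0 ≤ Ab := by positivity
  have hbound : ∀ s ∈ Icc 0 T, (∫⁻ x, ‖u s x‖ₑ ^ 2) +
      (∫⁻ x, ENNReal.ofReal (frobeniusNormSq (fderiv ℝ (u s) x))) ≤ ENNReal.ofReal Ab := by
    intro s hs
    have hL2 : ∫⁻ x, ‖u s x‖ₑ ^ 2 ≤ (D₀ : ℝ≥0∞) := by
      have h := hD₀ s hs
      have : ∀ x, ‖iteratedFDeriv ℝ 0 (u s) x‖ₑ = ‖u s x‖ₑ := fun x => by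
        rw [← ofReal_norm, ← ofReal_norm, norm_iteratedFDeriv_zero]
      simpa only [this] using h
    have hgrad : ∫⁻ x, ENNReal.ofReal (frobeniusNormSq (fderiv ℝ (u s) x)) ≤ 3 * (D₁ : ℝ≥0∞) :=
      (lintegral_frobeniusNormSq_le_three_mul_iteratedFDeriv_one (u s)).trans
        (mul_le_mul_right (hD₁ s hs) 3)
    calc (∫⁻ x, ‖u s x‖ₑ ^ 2) + (∫⁻ x, ENNReal.ofReal (frobeniusNormSq (fderiv ℝ (u s) x)))
        ≤ (D₀ : ℝ≥0∞) + 3 * (D₁ : ℝ≥0∞) := add_le_add hL2 hgrad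
      _ = ENNReal.ofReal Ab := by
          rw [hAbdef, ENNReal.ofReal_add (by positivity) (by positivity),
            ENNReal.ofReal_coe_nnreal, ENNReal.ofReal_mul (by norm_num),
            ENNReal.ofReal_coe_nnreal, ENNReal.ofReal_ofNat]
  obtain ⟨c, hc, hloc⟩ := w1aux_localExistenceAllDerivs
  set τ : ℝ := c * ν ^ 3 / (Ab ^ 2 + 1) with hτ
  have hτpos : 0 < τ := by positivity
  have hstep : ∀ ⦃s : ℝ⦄, 0 ≤ s → s < T → ∃ C : ℝ, ∀ t ∈ Icc s (min (s + τ) T), ∀ x : E3,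
      ‖iteratedFDerivWithin ℝ n (uncurry u) (Icc 0 T ×ˢ univ) (t, x)‖ ≤ C :=
    fun s hs0 hsT => windowRegularity_restart hc hloc hν hsol hH hAb hbound n hs0 hsT
  -- induction on the number of restarts
  have hind : ∀ k : ℕ, ∃ C : ℝ, ∀ t ∈ Icc 0 (min ((k : ℝ) * τ) T), ∀ x : E3,
      ‖iteratedFDerivWithin ℝ n (uncurry u) (Icc 0 T ×ˢ univ) (t, x)‖ ≤ C := by
    intro k
    induction k with
    | zero =>
      obtain ⟨C, hC⟩ := hstep le_rfl hT
      refine ⟨C, fun t ht x => hC t ?_ x⟩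
      rw [Nat.cast_zero, zero_mul, min_eq_left hT.le] at ht
      rw [zero_add]
      exact ⟨ht.1, ht.2.trans (le_min hτpos.le hT.le)⟩
    | succ k ih =>
      obtain ⟨C, hC⟩ := ih
      by_cases hkT : (k : ℝ) * τ < T
      · have hk0 : 0 ≤ (k : ℝ) * τ := by positivity
        obtain ⟨C', hC'⟩ := hstep hk0 hkT
        refine ⟨max C C', fun t ht x => ?_⟩
        rcases le_or_gt t ((k : ℝ) * τ) with hle | hgt
        · exact (hC t ⟨ht.1, le_min hle (ht.2.trans (min_le_right _ _))⟩ x).trans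
            (le_max_left _ _)
        · refine (hC' t ⟨hgt.le, ?_⟩ x).trans (le_max_right _ _)
          have : ((k + 1 : ℕ) : ℝ) * τ = (k : ℝ) * τ + τ := by push_cast; ring
          rw [this] at ht
          exact ht.2
      · have hkT' : T ≤ (k : ℝ) * τ := not_lt.1 hkT
        refine ⟨C, fun t ht x => hC t ?_ x⟩
        rw [min_eq_right hkT']
        have hk1 : T ≤ ((k + 1 : ℕ) : ℝ) * τ := by push_cast; nlinarith
        rw [min_eq_right hk1] at ht
        exact ht
  obtain ⟨k, hk⟩ : ∃ k : ℕ, T ≤ (k : ℝ) * τ := by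
    obtain ⟨k, hk⟩ := exists_nat_ge (T / τ)
    exact ⟨k, by rwa [div_le_iff₀ hτpos] at hk⟩
  obtain ⟨C, hC⟩ := hind k
  exact ⟨C, fun t ht x => hC t (by rwa [min_eq_right hk]) x⟩

/-- **Stub W1 — regularity of the drift on a closed sub-slab.** For a standing solution
(`0 < T`, classical on `[0, T)`, Leray–Hopf from `u 0`, rapidly decaying datum) and
`0 ≤ a < b < T`, the velocity is jointly smooth on `[a, b] × ℝ³` and every space–time derivative
of `uncurry u` within `[a, b] × ℝ³` is bounded there. Proof: restrict to the closed slab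
`[0, b']`, `b' = (b + T)/2` (`IsClassicalNSSolutionOn.mono`); finite energy there by the
Leray–Hopf energy inequality (`IsLerayHopfOn.lintegral_enorm_sq_le`); all Sobolev norms bounded by
Tao 2011, Cor. 11.1 + Cor. 4.3 + Thm. 5.4 (iv) (`tao2011_hasBoundedSobolevNormsOn_holds`, proved);
all joint derivatives bounded within `[0, b'] × ℝ³` (`windowRegularity_closedSlab`); the
derivatives within the smaller slab `[a, b] × ℝ³` agree with those within `[0, b'] × ℝ³`
(`iteratedFDerivWithin_subset`). -/
theorem stub_windowRegularity :
    ∀ (T : ℝ) (u : ℝ → E3 → E3) (p : ℝ → E3 → ℝ), 0 < T →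
    IsClassicalNSSolutionOn (Set.Ico 0 T) 1 0 u p → IsLerayHopfOn T 1 0 (u 0) u →
    HasRapidSpatialDecay (u 0) →
    ∀ a b : ℝ, 0 ≤ a → a < b → b < T →
    IsSmoothSpaceTimeOn (Set.Icc a b) u ∧
    ∀ n : ℕ, ∃ C : ℝ, ∀ t ∈ Set.Icc a b, ∀ x : E3,
      ‖iteratedFDerivWithin ℝ n (Function.uncurry u) (Set.Icc a b ×ˢ Set.univ) (t, x)‖ ≤ C := by
  intro T u p hT hcl hLH hdec a b ha hab hb
  have hab' : Icc a b ⊆ Ico 0 T := fun t ht => ⟨ha.trans ht.1, ht.2.trans_lt hb⟩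
  refine ⟨hcl.smooth_velocity.mono hab', fun n => ?_⟩
  -- the closed slab `[0, b']`, `b < b' < T`
  set b' : ℝ := (b + T) / 2 with hb'
  have hbb' : b < b' := by rw [hb']; linarith
  have hb'T : b' < T := by rw [hb']; linarith
  have hb'0 : 0 < b' := lt_of_le_of_lt (ha.trans hab.le) hbb'
  have hsol : IsClassicalNSSolutionOn (Icc 0 b') 1 0 u p :=
    hcl.mono (Icc_subset_Ico_right hb'T) (uniqueDiffOn_Icc hb'0)
  -- finite energy on `[0, b']` (Leray–Hopf energy inequality) and Tao's Sobolev bounds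
  have hE : ∃ C : ℝ≥0, ∀ t ∈ Icc 0 b', ∫⁻ x, ‖u t x‖ₑ ^ 2 ≤ C := by
    refine ⟨(ENNReal.ofReal (2 * VectorCalculus.kineticEnergy (u 0))).toNNReal, fun t ht => ?_⟩
    rw [ENNReal.coe_toNNReal ENNReal.ofReal_ne_top]
    exact hLH.lintegral_enorm_sq_le zero_le_one ⟨ht.1, ht.2.trans hb'T.le⟩
  have hH : HasBoundedSobolevNormsOn (Icc 0 b') u :=
    tao2011_hasBoundedSobolevNormsOn_holds one_pos hb'0 hsol hE hdec
  obtain ⟨C, hC⟩ := windowRegularity_closedSlab one_pos hb'0 hsol hH n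
  refine ⟨C, fun t ht x => ?_⟩
  have hsub : Icc a b ×ˢ (univ : Set E3) ⊆ Icc 0 b' ×ˢ univ :=
    prod_mono (Icc_subset_Icc ha hbb'.le) Subset.rfl
  have hsm : ContDiffOn ℝ n (uncurry u) (Icc 0 b' ×ˢ (univ : Set E3)) :=
    hsol.smooth_velocity.of_le (by exact_mod_cast le_top)
  rw [iteratedFDerivWithin_subset hsub ((uniqueDiffOn_Icc hab).prod uniqueDiffOn_univ)
    ((uniqueDiffOn_Icc hb'0).prod uniqueDiffOn_univ) hsm ⟨ht, mem_univ _⟩]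
  exact hC t ⟨ha.trans ht.1, ht.2.trans hbb'.le⟩ x

end Summit.NavierStokesRegularity.NavierStokesRegularity.Theorems

end
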